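import Summits.BirchSwinnertonDyer.BirchSwinnertonDyer.Theorems.SylvesterTwoHeegnerIndexCoupledTelescopeFlipCore
import Literature.NumberTheory.EllipticCurves.RingClassFieldFrobenius
import HarnessLib

/-!
# The COUPLED Cassels–Tate telescope, XXX: «every arithmetic Frobenius above `λ ∋ ℓ` fixes `κ⁻¹ ι z₀`» for a
# point read from a lower level `K[c]`, `ℓ ∤ c` (the displayed input `hPmFrob` of the FLIP core, RESIDUE c v3 (T-L1))

Crux `UpperOffV0HSYPlus` (stmt-BirchSwinnertonDyer-19804).  `SylvesterTwoCMFlip.flip_core_sylvesterTower` /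
`flip_upper{A,B}_sylvesterTower` (p726952 / p728746) display `hPmFrob : ∀ 𝔓 ∣ λ, ∀ F, IsArithFrobAt F 𝔓 →
F • κ⁻¹(ιe z₀) = κ⁻¹(ιe z₀)` for the lower point `z₀ = D_m y_m`, which comes from the level `K[9pm]`.  Gross
1991 §3 / McCallum 1991 §4: `λ = (ℓ)` is principal and prime to `c = 9pm`, so it splits completely in `K[c]/K`
and every Frobenius above it fixes `emb(K[c]) ⊆ K̄` pointwise (tree: `smul_ringHom_ringClassField_eq_self_of_span_natCast`,
`RingClassFieldFrobenius`), hence fixes the image of every `K[c]`-rational point (`smul_embPoints_eq_self`) and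
its transport along the `Γ_K`-equivariant frame `κ`.  Stated for a general conductor `c` with `ℓ ∤ c` and a
COHERENCE datum `X = ιe' z₀'` (`X` the point at the working level, `z₀'` its source at level `c` with its own
embedding `emb'`, as #F-BlockTwo's `hPm`) — the assembler's `hPmFrob` for (T9b) at every `(ℓ, m)`.
* ★ `smul_frame_symm_eq_self_of_isArithFrobAt`, `asIdeal_eq_span_of_mem` (the place above an inert `ℓ` is `(ℓ)`).
Theorems only; nothing asserted on 19804; no stub closed; X12.CMAtTwo NOT proved; BSD not claimed for any curve.
Sources: [GrossLMS1991] §3 (proof of Prop. 3.7); [McCallumLMS1991] §4 (Prop. 4.4: "`λ` splits completely in `K_m`").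
`lean search 'smul_frame_symm'` → nothing before this file.
-/

set_option linter.dupNamespace false -- Summits modules are `Summit.<Summit>.<Problem>…` by design
set_option autoImplicit false

noncomputable section

open scoped Classical

namespace Summit.BirchSwinnertonDyer.BirchSwinnertonDyer.Theorems.SylvesterTwoCMFlip

open WeierstrassCurve Field NumberField IsDedekindDomain
open Literature.NumberTheory.EllipticCurves Literature.NumberTheory.GaloisRepresentations
  Literature.NumberTheory.EllipticCurves.HuShuYin2019
  Summit.BirchSwinnertonDyer.BirchSwinnertonDyer.Theorems.SylvesterTwoCMData

variable {K : Type} [Field K] [NumberField K]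

/-- The finite place `v ∋ ℓ` of `K` above a prime `ℓ` INERT in `K` is `λ = (ℓ)`: `(ℓ)` is a non-zero prime,
hence maximal, ideal contained in `v`. [cite: GrossLMS1991, §3 (after (3.2): "its unique prime factor λ")] -/
theorem asIdeal_eq_span_of_mem {ℓ : ℕ} (hℓ : ℓ.Prime) (hinert : (Ideal.span {(ℓ : 𝓞 K)}).IsPrime)
    {v : HeightOneSpectrum (𝓞 K)} (hv : (ℓ : 𝓞 K) ∈ v.asIdeal) :
    v.asIdeal = Ideal.span {((ℓ : ℕ) : 𝓞 K)} := by
  have hne : Ideal.span {(ℓ : 𝓞 K)} ≠ ⊥ := by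
    rw [Ne, Ideal.span_singleton_eq_bot]
    exact_mod_cast hℓ.ne_zero
  exact ((hinert.isMaximal hne).eq_of_le v.isPrime.ne_top ((Ideal.span_singleton_le_iff_mem _).mpr hv)).symm

/-- ★ **Every arithmetic Frobenius above `λ ∋ ℓ` fixes `κ⁻¹ X` for a point `X = ιe' z₀'` read from `K[c]`,
`ℓ ∤ c`** (`K ∋ ω`, `ℓ ≡ 2 (3)` so `ℓ` is inert; `κ` a `Γ_K`-equivariant frame transport): the displayed input
`hPmFrob` of `flip_core_sylvesterTower` at every level. [cite: GrossLMS1991, §3 (proof of Prop. 3.7)]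
[cite: McCallumLMS1991, §4 (Prop. 4.4)] -/
theorem smul_frame_symm_eq_self_of_isArithFrobAt {ω : K} (hω : ω ^ 2 + ω + 1 = 0)
    (h2 : Module.finrank ℚ K = 2) (ι : K →+* ℂ) {W₀ : WeierstrassCurve ℚ} {c ℓ : ℕ} (hc : c ≠ 0)
    (hℓ : ℓ.Prime) (hℓ3 : ℓ % 3 = 2) (hℓc : ¬ ℓ ∣ c)
    (κ : geomPoints ((cubeSumCurve 9).baseChange K) ≃+ geomPoints (W₀.baseChange K))
    (hκG : ∀ (g : absoluteGaloisGroup K) (P : geomPoints ((cubeSumCurve 9).baseChange K)), κ (g • P) = g • κ P)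
    (emb' : ringClassField K ι c →+* AlgebraicClosure K)
    (hemb' : ∀ k : K, emb' (algebraMap K (ringClassField K ι c) k) = algebraMap K (AlgebraicClosure K) k)
    (ιe' : letI : DecidableEq (ringClassField K ι c) := fun a b ↦ Classical.propDecidable (a = b)
      (W₀.baseChange (ringClassField K ι c)).toAffine.Point →+ geomPoints (W₀.baseChange K))
    (hιe' : ∀ P, ιe' P = Affine.Point.map (W' := W₀) emb'.toRatAlgHom P)
    {X : geomPoints (W₀.baseChange K)}
    {z₀' : letI : DecidableEq (ringClassField K ι c) := fun a b ↦ Classical.propDecidable (a = b)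
      (W₀.baseChange (ringClassField K ι c)).toAffine.Point} (hX : X = ιe' z₀')
    {v : HeightOneSpectrum (𝓞 K)} (hv : (ℓ : 𝓞 K) ∈ v.asIdeal)
    {𝔓 : Ideal (absIntegers (𝓞 K) K)} (h𝔓 : 𝔓 ∈ v.primesAbove)
    {F : absoluteGaloisGroup K} (hF : IsArithFrobAt (𝓞 K) F 𝔓) :
    F • κ.symm X = κ.symm X := by
  have hK := JZero.isImaginaryQuadratic_of_sq_add_self_add_one hω h2
  have hinert := JZero.span_natCast_isPrime_of_mod_three_eq_two hω h2 hℓ hℓ3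
  haveI := (finiteDimensional_and_isGalois_ringClassField hK ι hc).2
  have hvℓ := asIdeal_eq_span_of_mem hℓ hinert hv
  have hcop : Nat.Coprime ℓ c := (Nat.Prime.coprime_iff_not_dvd hℓ).mpr hℓc
  have hfix : ∀ x : ringClassField K ι c, (show AlgebraicClosure K ≃ₐ[K] AlgebraicClosure K from F) (emb' x) = emb' x := fun x ↦
    smul_ringHom_ringClassField_eq_self_of_span_natCast hK ι hc emb' hemb' hvℓ hcop h𝔓 hF x
  apply κ.injective
  rw [hκG, κ.apply_symm_apply, hX]
  exact smul_embPoints_eq_self W₀ emb' ιe' hιe' F hfix _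

end Summit.BirchSwinnertonDyer.BirchSwinnertonDyer.Theorems.SylvesterTwoCMFlip

end
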